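import Summits.KontsevichZagierPeriods.KontsevichZagierPeriods.Theorems.RootDecompZetaThreeFrontierWordMatchPreludeP2

/-! # `RootDecompZetaThreeFrontierWordMatchPreludeP3` — part 3/5 of the mechanical ≤360-line split of `MatchPrelude.stripped.lean`
(split by the decomp-kz census seat for landing; mathematics unchanged; part 3 continues part 2). -/

noncomputable section
set_option linter.dupNamespace false

noncomputable section
set_option linter.dupNamespace false
open Set MeasureTheory MvPolynomial
open Literature.NumberTheory.Transcendental
open Summit.KontsevichZagierPeriods.KontsevichZagierPeriods.Theorems.RootDecompZetaThreeFrontierWordMoves (mem_simplex_three_iff)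

namespace Summit.KontsevichZagierPeriods.RootDecompZetaThreeFrontier.WordLayer

section LayerConv

/-! (private copy of `measurableSet_simplex` — its public twin in this chain was privatised under the dedup.landed policy) -/
/-- `simplex` is measurable. [bookkeeping] -/
private theorem measurableSet_simplex (k : ℕ) : MeasurableSet (KZ.openOrderedSimplex k) :=
  Literature.ModelTheory.ExponentialFields.IsSemialgebraic.measurableSet_holds (KZ.isSemialgebraic_openOrderedSimplex k)

/-! (private copy of `continuous_aeval_fin` — its public twin in this chain was privatised under the dedup.landed policy) -/
/-- Auxiliary step `continuous_aeval_fin`. [bookkeeping] -/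
private theorem continuous_aeval_fin {n : ℕ} (p : MvPolynomial (Fin n) ℚ) :
    Continuous fun x : Fin n → ℝ => MvPolynomial.aeval x p := by
  have : (fun x : Fin n → ℝ => MvPolynomial.aeval x p) =
      fun x => MvPolynomial.eval x (MvPolynomial.map (algebraMap ℚ ℝ) p) := by
    funext x; rw [MvPolynomial.eval_map, MvPolynomial.aeval_def]
  rw [this]
  exact MvPolynomial.continuous_eval _

/-! (private copy of `aeval_eq_sum_three` — its public twin in this chain was privatised under the dedup.landed policy) -/
/-- Auxiliary step `aeval_eq_sum_three`. [bookkeeping] -/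
private theorem aeval_eq_sum_three (p : MvPolynomial (Fin 3) ℚ) (t : Fin 3 → ℝ) :
    MvPolynomial.aeval t p =
      ∑ m ∈ p.support, ((MvPolynomial.coeff m p : ℚ) : ℝ) * (t 0 ^ (m 0) * t 1 ^ (m 1) * t 2 ^ (m 2)) := by
  rw [MvPolynomial.aeval_def, MvPolynomial.eval₂_eq']
  refine Finset.sum_congr rfl fun m _ => ?_
  simp [Fin.prod_univ_three, eq_ratCast]

/-- `(1-x)^a` is integrable on `(0,1)` for every real `a > -1` -/
theorem integrableOn_one_sub_rpow {a : ℝ} (ha : -1 < a) : IntegrableOn (fun x : ℝ => (1 - x) ^ a) (Ioo 0 1) := by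
  have h1 : IntervalIntegrable (fun x : ℝ => x ^ a) volume 0 1 := intervalIntegral.intervalIntegrable_rpow' ha
  have h2 : IntervalIntegrable (fun x : ℝ => (1 - x) ^ a) volume (1 - 0) (1 - 1) := h1.comp_sub_left 1
  rw [sub_zero, sub_self] at h2
  have h3 := (intervalIntegrable_iff_integrableOn_Ioc_of_le zero_le_one).1 h2.symm
  exact h3.mono_set Ioo_subset_Ioc_self

/-- a product of one-variable powers `∏ (1-yᵢ)^{aᵢ}`, all `aᵢ > -1`, is integrable on the cube -/
theorem integrableOn_cube_rpow (a : Fin 3 → ℝ) (ha : ∀ i, -1 < a i) :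
    IntegrableOn (fun y : Fin 3 → ℝ => ∏ i, (1 - y i) ^ a i) Cube3 := by
  rw [IntegrableOn, Cube3_eq_pi, volume_pi, Measure.restrict_pi_pi]
  exact Integrable.fintype_prod (f := fun i x => (1 - x) ^ a i) (fun i => integrableOn_one_sub_rpow (ha i))

/-! ### 25c  The max/AM–GM bounds `1/(1-uv) ≤ (1-u)^{-a}(1-v)^{-b}` -/

/-- Auxiliary step `rpow_mul_rpow_le_max`. [bookkeeping] -/
theorem rpow_mul_rpow_le_max {x y a b : ℝ} (hx : 0 ≤ x) (hy : 0 ≤ y) (ha : 0 ≤ a) (hb : 0 ≤ b) (hab : a + b = 1) :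
    x ^ a * y ^ b ≤ max x y := by
  have hm : 0 ≤ max x y := hx.trans (le_max_left _ _)
  calc x ^ a * y ^ b ≤ (max x y) ^ a * (max x y) ^ b :=
        mul_le_mul (Real.rpow_le_rpow hx (le_max_left _ _) ha) (Real.rpow_le_rpow hy (le_max_right _ _) hb)
          (Real.rpow_nonneg hy _) (Real.rpow_nonneg hm _)
    _ = max x y := by rw [← Real.rpow_add_of_nonneg hm ha hb, hab, Real.rpow_one]

/-- Auxiliary step `rpow3_le_max`. [bookkeeping] -/
theorem rpow3_le_max {x y z a b c : ℝ} (hx : 0 ≤ x) (hy : 0 ≤ y) (hz : 0 ≤ z) (ha : 0 ≤ a) (hb : 0 ≤ b) (hc : 0 ≤ c)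
    (habc : a + b + c = 1) : x ^ a * y ^ b * z ^ c ≤ max (max x y) z := by
  set m := max (max x y) z with hm_def
  have hxm : x ≤ m := (le_max_left _ _).trans (le_max_left _ _)
  have hym : y ≤ m := (le_max_right _ _).trans (le_max_left _ _)
  have hzm : z ≤ m := le_max_right _ _
  have hm : 0 ≤ m := hx.trans hxm
  calc x ^ a * y ^ b * z ^ c ≤ m ^ a * m ^ b * m ^ c :=
        mul_le_mul (mul_le_mul (Real.rpow_le_rpow hx hxm ha) (Real.rpow_le_rpow hy hym hb) (Real.rpow_nonneg hy _)
          (Real.rpow_nonneg hm _)) (Real.rpow_le_rpow hz hzm hc) (Real.rpow_nonneg hz _)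
          (mul_nonneg (Real.rpow_nonneg hm _) (Real.rpow_nonneg hm _))
    _ = m := by
        rw [← Real.rpow_add_of_nonneg hm ha hb, ← Real.rpow_add_of_nonneg hm (add_nonneg ha hb) hc, habc,
          Real.rpow_one]

/-- `1/(1-uv) ≤ (1-u)^{-a}(1-v)^{-b}` for `u, v ∈ [0,1)`, `a, b ≥ 0`, `a+b = 1` -/
theorem one_div_le_rpow2 {u v a b : ℝ} (hu0 : 0 ≤ u) (hu1 : u < 1) (hv0 : 0 ≤ v) (hv1 : v < 1) (ha : 0 ≤ a) (hb : 0 ≤ b)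
    (hab : a + b = 1) : 1 / (1 - u * v) ≤ (1 - u) ^ (-a) * (1 - v) ^ (-b) := by
  have hu' : 0 < 1 - u := by linarith
  have hv' : 0 < 1 - v := by linarith
  have hmax : max (1 - u) (1 - v) ≤ 1 - u * v := max_le (by nlinarith) (by nlinarith)
  have hprod : (1 - u) ^ a * (1 - v) ^ b ≤ 1 - u * v := (rpow_mul_rpow_le_max hu'.le hv'.le ha hb hab).trans hmax
  have hpos : 0 < (1 - u) ^ a * (1 - v) ^ b := mul_pos (Real.rpow_pos_of_pos hu' _) (Real.rpow_pos_of_pos hv' _)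
  rw [Real.rpow_neg hu'.le, Real.rpow_neg hv'.le, ← mul_inv, ← one_div]
  exact one_div_le_one_div_of_le hpos hprod

/-- `1/(1-uvw) ≤ (1-u)^{-a}(1-v)^{-b}(1-w)^{-c}` for `u, v, w ∈ [0,1)`, `a, b, c ≥ 0`, `a+b+c = 1` -/
theorem one_div_le_rpow3 {u v w a b c : ℝ} (hu0 : 0 ≤ u) (hu1 : u < 1) (hv0 : 0 ≤ v) (hv1 : v < 1) (hw0 : 0 ≤ w)
    (hw1 : w < 1) (ha : 0 ≤ a) (hb : 0 ≤ b) (hc : 0 ≤ c) (habc : a + b + c = 1) :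
    1 / (1 - u * v * w) ≤ (1 - u) ^ (-a) * (1 - v) ^ (-b) * (1 - w) ^ (-c) := by
  have hu' : 0 < 1 - u := by linarith
  have hv' : 0 < 1 - v := by linarith
  have hw' : 0 < 1 - w := by linarith
  have huv : u * v ≤ 1 := by nlinarith
  have hmax : max (max (1 - u) (1 - v)) (1 - w) ≤ 1 - u * v * w :=
    max_le (max_le (by nlinarith [mul_nonneg hu0 hv0, mul_le_of_le_one_right hu0 (show v * w ≤ 1 by nlinarith)])
      (by nlinarith [mul_nonneg hu0 hv0, mul_nonneg (mul_nonneg hu0 hv0) hw0])) (by nlinarith [mul_nonneg hu0 hv0])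
  have hprod : (1 - u) ^ a * (1 - v) ^ b * (1 - w) ^ c ≤ 1 - u * v * w :=
    (rpow3_le_max hu'.le hv'.le hw'.le ha hb hc habc).trans hmax
  have hpos : 0 < (1 - u) ^ a * (1 - v) ^ b * (1 - w) ^ c :=
    mul_pos (mul_pos (Real.rpow_pos_of_pos hu' _) (Real.rpow_pos_of_pos hv' _)) (Real.rpow_pos_of_pos hw' _)
  rw [Real.rpow_neg hu'.le, Real.rpow_neg hv'.le, Real.rpow_neg hw'.le, ← mul_inv, ← mul_inv, ← one_div]
  exact one_div_le_one_div_of_le hpos hprod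

/-! ### 25d  The two model majorants `M = 1/(t₀t₁(1-t₁)(1-t₂))`, `M_d = 1/(t₁(1-t₁)(t₀-t₂))` are integrable on `Δ₃` -/

/-- `M(t) = 1/(t₀t₁(1-t₁)(1-t₂))`: the common majorant of the four non-diagonal maximal layer patterns -/
def layM (t : Fin 3 → ℝ) : ℝ := 1 / (t 0 * t 1 * (1 - t 1) * (1 - t 2))

/-- `M_d(t) = 1/(t₁(1-t₁)(t₀-t₂))`: the common majorant of the four diagonal maximal layer patterns -/
def layMd (t : Fin 3 → ℝ) : ℝ := 1 / (t 1 * (1 - t 1) * (t 0 - t 2))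

/-- domination on the cube by a product of one-variable powers gives integrability -/
theorem integrableOn_cube_of_le {G : (Fin 3 → ℝ) → ℝ} (hG : ContinuousOn G Cube3) (a : Fin 3 → ℝ) (ha : ∀ i, -1 < a i)
    (hle : ∀ y ∈ Cube3, |G y| ≤ ∏ i, (1 - y i) ^ a i) : IntegrableOn G Cube3 := by
  refine Integrable.mono' (integrableOn_cube_rpow a ha) (hG.aestronglyMeasurable measurableSet_Cube3) ?_
  rw [ae_restrict_iff' measurableSet_Cube3]
  exact Filter.Eventually.of_forall fun y hy => by rw [Real.norm_eq_abs]; exact hle y hy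

/-- Auxiliary step `prod_three_rpow`. [bookkeeping] -/
theorem prod_three_rpow (y : Fin 3 → ℝ) (a : Fin 3 → ℝ) :
    ∏ i, (1 - y i) ^ a i = (1 - y 0) ^ a 0 * (1 - y 1) ^ a 1 * (1 - y 2) ^ a 2 := by
  rw [Fin.prod_univ_three]

/-- `M` in the vertex chart: `y₂²y₀·M(Ψ₃ y) = 1/((1-y₂y₀)(1-y₂y₀y₁))` -/
theorem layM_chart {y : Fin 3 → ℝ} (hy : y ∈ Cube3) :
    y 2 ^ 2 * y 0 * layM (vΨ y) = 1 / ((1 - y 2 * y 0) * (1 - y 2 * y 0 * y 1)) := by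
  obtain ⟨h0, h01, h1, h11, h2, h21⟩ := hy
  have hA : 0 < 1 - y 2 * y 0 := by nlinarith
  have hB : 0 < 1 - y 2 * y 0 * y 1 := by nlinarith [mul_pos h2 h0]
  rw [layM, vΨ_zero, vΨ_one, vΨ_two]
  field_simp

/-- `M_d` in the vertex chart: `y₂²y₀·M_d(Ψ₃ y) = 1/((1-y₂y₀)(1-y₀y₁))` -/
theorem layMd_chart {y : Fin 3 → ℝ} (hy : y ∈ Cube3) :
    y 2 ^ 2 * y 0 * layMd (vΨ y) = 1 / ((1 - y 2 * y 0) * (1 - y 0 * y 1)) := by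
  obtain ⟨h0, h01, h1, h11, h2, h21⟩ := hy
  have hA : 0 < 1 - y 2 * y 0 := by nlinarith
  have hB : 0 < 1 - y 0 * y 1 := by nlinarith
  rw [layMd, vΨ_zero, vΨ_one, vΨ_two]
  have : y 2 - y 2 * y 0 * y 1 = y 2 * (1 - y 0 * y 1) := by ring
  rw [this]
  field_simp

/-- exponents `(-3/4, -1/2, -3/4)` dominate `M` in the chart -/
def aM : Fin 3 → ℝ := ![-(3/4 : ℝ), -(1/2 : ℝ), -(3/4 : ℝ)]

/-- exponents `(-2/3, -2/3, -2/3)` dominate `M_d` in the chart -/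
def aMd : Fin 3 → ℝ := ![-(2/3 : ℝ), -(2/3 : ℝ), -(2/3 : ℝ)]

/-- Auxiliary step `layM_chart_le`. [bookkeeping] -/
theorem layM_chart_le {y : Fin 3 → ℝ} (hy : y ∈ Cube3) :
    1 / ((1 - y 2 * y 0) * (1 - y 2 * y 0 * y 1)) ≤ ∏ i, (1 - y i) ^ aM i := by
  obtain ⟨h0, h01, h1, h11, h2, h21⟩ := hy
  have h0' : 0 < 1 - y 0 := by linarith
  have h2' : 0 < 1 - y 2 := by linarith
  have hApos : 0 < 1 - y 2 * y 0 := by nlinarith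
  have A : 1 / (1 - y 2 * y 0) ≤ (1 - y 2) ^ (-(1/2:ℝ)) * (1 - y 0) ^ (-(1/2:ℝ)) :=
    one_div_le_rpow2 h2.le h21 h0.le h01 (by norm_num) (by norm_num) (by norm_num)
  have B : 1 / (1 - y 2 * y 0 * y 1) ≤ (1 - y 2) ^ (-(1/4:ℝ)) * (1 - y 0) ^ (-(1/4:ℝ)) * (1 - y 1) ^ (-(1/2:ℝ)) :=
    one_div_le_rpow3 h2.le h21 h0.le h01 h1.le h11 (by norm_num) (by norm_num) (by norm_num) (by norm_num)
  have hBpos : 0 < 1 - y 2 * y 0 * y 1 := by nlinarith [mul_pos h2 h0]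
  have hA0 : 0 ≤ 1 / (1 - y 2 * y 0) := by positivity
  have hB0 : 0 ≤ 1 / (1 - y 2 * y 0 * y 1) := by positivity
  calc 1 / ((1 - y 2 * y 0) * (1 - y 2 * y 0 * y 1))
        = (1 / (1 - y 2 * y 0)) * (1 / (1 - y 2 * y 0 * y 1)) := by rw [one_div_mul_one_div]
    _ ≤ ((1 - y 2) ^ (-(1/2:ℝ)) * (1 - y 0) ^ (-(1/2:ℝ))) *
          ((1 - y 2) ^ (-(1/4:ℝ)) * (1 - y 0) ^ (-(1/4:ℝ)) * (1 - y 1) ^ (-(1/2:ℝ))) := mul_le_mul A B hB0 (hA0.trans A)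
    _ = ∏ i, (1 - y i) ^ aM i := by
        rw [prod_three_rpow]
        simp only [aM, Matrix.cons_val_zero, Matrix.cons_val_one, Matrix.head_cons, Matrix.cons_val_two, Matrix.tail_cons]
        rw [show (-(3/4:ℝ)) = -(1/2:ℝ) + -(1/4:ℝ) by norm_num, Real.rpow_add h0', Real.rpow_add h2']
        ring

/-- Auxiliary step `layMd_chart_le`. [bookkeeping] -/
theorem layMd_chart_le {y : Fin 3 → ℝ} (hy : y ∈ Cube3) :
    1 / ((1 - y 2 * y 0) * (1 - y 0 * y 1)) ≤ ∏ i, (1 - y i) ^ aMd i := by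
  obtain ⟨h0, h01, h1, h11, h2, h21⟩ := hy
  have h0' : 0 < 1 - y 0 := by linarith
  have hApos : 0 < 1 - y 2 * y 0 := by nlinarith
  have A : 1 / (1 - y 2 * y 0) ≤ (1 - y 2) ^ (-(2/3:ℝ)) * (1 - y 0) ^ (-(1/3:ℝ)) :=
    one_div_le_rpow2 h2.le h21 h0.le h01 (by norm_num) (by norm_num) (by norm_num)
  have B : 1 / (1 - y 0 * y 1) ≤ (1 - y 0) ^ (-(1/3:ℝ)) * (1 - y 1) ^ (-(2/3:ℝ)) :=
    one_div_le_rpow2 h0.le h01 h1.le h11 (by norm_num) (by norm_num) (by norm_num)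
  have hBpos : 0 < 1 - y 0 * y 1 := by nlinarith
  have hA0 : 0 ≤ 1 / (1 - y 2 * y 0) := by positivity
  have hB0 : 0 ≤ 1 / (1 - y 0 * y 1) := by positivity
  calc 1 / ((1 - y 2 * y 0) * (1 - y 0 * y 1))
        = (1 / (1 - y 2 * y 0)) * (1 / (1 - y 0 * y 1)) := by rw [one_div_mul_one_div]
    _ ≤ ((1 - y 2) ^ (-(2/3:ℝ)) * (1 - y 0) ^ (-(1/3:ℝ))) * ((1 - y 0) ^ (-(1/3:ℝ)) * (1 - y 1) ^ (-(2/3:ℝ))) :=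
        mul_le_mul A B hB0 (hA0.trans A)
    _ = ∏ i, (1 - y i) ^ aMd i := by
        rw [prod_three_rpow]
        simp only [aMd, Matrix.cons_val_zero, Matrix.cons_val_one, Matrix.head_cons, Matrix.cons_val_two, Matrix.tail_cons]
        rw [show (-(2/3:ℝ)) = -(1/3:ℝ) + -(1/3:ℝ) by norm_num, Real.rpow_add h0']
        ring

/-- **`M` is integrable on `Δ₃`** -/
theorem layM_integrableOn : IntegrableOn layM (KZ.openOrderedSimplex 3) := by
  have hG : ContinuousOn (fun y : Fin 3 → ℝ => 1 / ((1 - y 2 * y 0) * (1 - y 2 * y 0 * y 1))) Cube3 := by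
    refine continuousOn_const.div (Continuous.continuousOn (by fun_prop)) fun y hy => ?_
    obtain ⟨h0, h01, h1, h11, h2, h21⟩ := hy
    exact (mul_pos (by nlinarith) (by nlinarith [mul_pos h2 h0])).ne'
  have hI : IntegrableOn (fun y : Fin 3 → ℝ => 1 / ((1 - y 2 * y 0) * (1 - y 2 * y 0 * y 1))) Cube3 := by
    refine integrableOn_cube_of_le hG aM (fun i => by fin_cases i <;> norm_num [aM]) fun y hy => ?_
    obtain ⟨h0, h01, h1, h11, h2, h21⟩ := hy
    rw [abs_of_pos (by exact one_div_pos.2 (mul_pos (by nlinarith) (by nlinarith [mul_pos h2 h0])))]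
    exact layM_chart_le ⟨h0, h01, h1, h11, h2, h21⟩
  exact integrableOn_of_vchart ((hI.congr_fun (fun y hy => (layM_chart hy).symm) measurableSet_Cube3))

/-- **`M_d` is integrable on `Δ₃`** -/
theorem layMd_integrableOn : IntegrableOn layMd (KZ.openOrderedSimplex 3) := by
  have hG : ContinuousOn (fun y : Fin 3 → ℝ => 1 / ((1 - y 2 * y 0) * (1 - y 0 * y 1))) Cube3 := by
    refine continuousOn_const.div (Continuous.continuousOn (by fun_prop)) fun y hy => ?_
    obtain ⟨h0, h01, h1, h11, h2, h21⟩ := hy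
    exact (mul_pos (by nlinarith) (by nlinarith)).ne'
  have hI : IntegrableOn (fun y : Fin 3 → ℝ => 1 / ((1 - y 2 * y 0) * (1 - y 0 * y 1))) Cube3 := by
    refine integrableOn_cube_of_le hG aMd (fun i => by fin_cases i <;> norm_num [aMd]) fun y hy => ?_
    obtain ⟨h0, h01, h1, h11, h2, h21⟩ := hy
    rw [abs_of_pos (by exact one_div_pos.2 (mul_pos (by nlinarith) (by nlinarith)))]
    exact layMd_chart_le ⟨h0, h01, h1, h11, h2, h21⟩
  exact integrableOn_of_vchart ((hI.congr_fun (fun y hy => (layMd_chart hy).symm) measurableSet_Cube3))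

/-! ### 25e  Every LAYER class is dominated by `‖P‖₁·(M + M_d)`, hence absolutely integrable on `Δ₃` -/

/-- Auxiliary step `pair_le`. [bookkeeping] -/
theorem pair_le {x y : ℝ} (hy0 : 0 ≤ y) (hyx : y ≤ x) (hx1 : x ≤ 1) {a b : ℕ} (hb : b ≤ 1) (hab : a + b ≤ 2) :
    x * y ≤ x ^ a * y ^ b := by
  have hx0 : 0 ≤ x := hy0.trans hyx
  interval_cases b
  · rw [pow_zero, mul_one]
    calc x * y ≤ x * x := mul_le_mul_of_nonneg_left hyx hx0
      _ = x ^ 2 := (sq x).symm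
      _ ≤ x ^ a := pow_le_pow_of_le_one hx0 hx1 (by omega)
  · rw [pow_one]
    exact mul_le_mul_of_nonneg_right (by simpa using pow_le_pow_of_le_one hx0 hx1 (show a ≤ 1 by omega)) hy0

/-- Auxiliary step `single_le`. [bookkeeping] -/
theorem single_le {x y : ℝ} (hyx : y ≤ x) (hx1 : x ≤ 1) {a b : ℕ} (hab : a + b ≤ 1) :
    y ≤ x ^ a * y ^ b := by
  have ha : a ≤ 1 := by omega
  have hb : b ≤ 1 := by omega
  interval_cases a <;> interval_cases b
  · simpa using hyx.trans hx1
  · simp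
  · simpa using hyx
  · omega

/-- the INVERSE LAYER DENOMINATOR is `≤ M + M_d` on `Δ₃` (`α,β₁,γ₁ ≤ 1`, `β₀+β₁+α ≤ 2`, `γ₂+γ₁+α ≤ 2`) -/
theorem inv_layerDen_le {t : Fin 3 → ℝ} (ht : t ∈ KZ.openOrderedSimplex 3) {β₀ β₁ γ₁ γ₂ α : ℕ} (hα : α ≤ 1)
    (hβ : β₁ ≤ 1) (hγ : γ₁ ≤ 1) (h0 : β₀ + β₁ + α ≤ 2) (h1 : γ₂ + γ₁ + α ≤ 2) :
    1 / (t 0 ^ β₀ * t 1 ^ β₁ * (1 - t 1) ^ γ₁ * (1 - t 2) ^ γ₂ * (t 0 - t 2) ^ α) ≤ layM t + layMd t := by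
  obtain ⟨h2, h21, h10, h0'⟩ := (mem_simplex_three_iff t).1 ht
  have ht1 : 0 < t 1 := h2.trans h21
  have ht0 : 0 < t 0 := ht1.trans h10
  have hu1 : 0 < 1 - t 1 := by linarith
  have hu2 : 0 < 1 - t 2 := by linarith
  have hd : 0 < t 0 - t 2 := by linarith
  have hM : 0 ≤ layM t := by unfold layM; positivity
  have hMd : 0 ≤ layMd t := by unfold layMd; positivity
  have A2 : t 0 * t 1 ≤ t 0 ^ β₀ * t 1 ^ β₁ → (1 - t 2) * (1 - t 1) ≤ (1 - t 2) ^ γ₂ * (1 - t 1) ^ γ₁ →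
      t 0 * t 1 * (1 - t 1) * (1 - t 2) ≤ t 0 ^ β₀ * t 1 ^ β₁ * (1 - t 1) ^ γ₁ * (1 - t 2) ^ γ₂ := fun A B =>
    calc t 0 * t 1 * (1 - t 1) * (1 - t 2) = (t 0 * t 1) * ((1 - t 2) * (1 - t 1)) := by ring
      _ ≤ (t 0 ^ β₀ * t 1 ^ β₁) * ((1 - t 2) ^ γ₂ * (1 - t 1) ^ γ₁) :=
          mul_le_mul A B (by positivity) (by positivity)
      _ = _ := by ring
  interval_cases α
  · refine le_add_of_le_of_nonneg ?_ hMd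
    rw [pow_zero, mul_one]
    unfold layM
    refine one_div_le_one_div_of_le (by positivity) (A2 ?_ ?_)
    · exact pair_le ht1.le h10.le h0'.le hβ (by omega)
    · exact pair_le hu1.le (by linarith) (by linarith) hγ (by omega)
  · refine le_add_of_nonneg_of_le hM ?_
    rw [pow_one]
    unfold layMd
    refine one_div_le_one_div_of_le (by positivity) ?_
    have A : t 1 ≤ t 0 ^ β₀ * t 1 ^ β₁ := single_le h10.le h0'.le (by omega)
    have B : 1 - t 1 ≤ (1 - t 2) ^ γ₂ * (1 - t 1) ^ γ₁ := single_le (by linarith) (by linarith) (by omega)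
    calc t 1 * (1 - t 1) * (t 0 - t 2) ≤ (t 0 ^ β₀ * t 1 ^ β₁) * ((1 - t 2) ^ γ₂ * (1 - t 1) ^ γ₁) * (t 0 - t 2) :=
          mul_le_mul_of_nonneg_right (mul_le_mul A B hu1.le (by positivity)) hd.le
      _ = _ := by ring

/-- `‖P‖₁ = Σ |coefficients|` -/
def coeffAbsSum (P : MvPolynomial (Fin 3) ℚ) : ℝ := ∑ e ∈ P.support, |((MvPolynomial.coeff e P : ℚ) : ℝ)|

/-- Auxiliary step `coeffAbsSum_nonneg`. [bookkeeping] -/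
theorem coeffAbsSum_nonneg (P : MvPolynomial (Fin 3) ℚ) : 0 ≤ coeffAbsSum P :=
  Finset.sum_nonneg fun _ _ => abs_nonneg _

/-- `|P(t)| ≤ ‖P‖₁` on `Δ₃` (indeed on the closed cube) -/
theorem abs_aeval_le (P : MvPolynomial (Fin 3) ℚ) {t : Fin 3 → ℝ} (ht : t ∈ KZ.openOrderedSimplex 3) :
    |MvPolynomial.aeval t P| ≤ coeffAbsSum P := by
  obtain ⟨h2, h21, h10, h0'⟩ := (mem_simplex_three_iff t).1 ht
  have ht1 : 0 < t 1 := h2.trans h21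
  have ht0 : 0 < t 0 := ht1.trans h10
  rw [aeval_eq_sum_three, coeffAbsSum]
  refine (Finset.abs_sum_le_sum_abs _ _).trans (Finset.sum_le_sum fun e _ => ?_)
  rw [abs_mul]
  have hmon : |t 0 ^ e 0 * t 1 ^ e 1 * t 2 ^ e 2| ≤ 1 := by
    rw [abs_of_nonneg (by positivity)]
    calc t 0 ^ e 0 * t 1 ^ e 1 * t 2 ^ e 2 ≤ 1 * 1 * 1 :=
          mul_le_mul (mul_le_mul (pow_le_one₀ ht0.le h0'.le) (pow_le_one₀ ht1.le (by linarith)) (by positivity)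
            zero_le_one) (pow_le_one₀ h2.le (by linarith)) (by positivity) (by positivity)
      _ = 1 := by ring
  calc |((MvPolynomial.coeff e P : ℚ) : ℝ)| * |t 0 ^ e 0 * t 1 ^ e 1 * t 2 ^ e 2|
        ≤ |((MvPolynomial.coeff e P : ℚ) : ℝ)| * 1 := mul_le_mul_of_nonneg_left hmon (abs_nonneg _)
    _ = _ := mul_one _

/-- the LAYER INTEGRAND `P/(t₀^β₀ t₁^β₁ (1-t₁)^γ₁ (1-t₂)^γ₂ (t₀-t₂)^α)` -/
def layerF (P : MvPolynomial (Fin 3) ℚ) (β₀ β₁ γ₁ γ₂ α : ℕ) (t : Fin 3 → ℝ) : ℝ :=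
  MvPolynomial.aeval t P / (t 0 ^ β₀ * t 1 ^ β₁ * (1 - t 1) ^ γ₁ * (1 - t 2) ^ γ₂ * (t 0 - t 2) ^ α)

/-- Auxiliary step `layerDen_pos`. [bookkeeping] -/
theorem layerDen_pos {t : Fin 3 → ℝ} (ht : t ∈ KZ.openOrderedSimplex 3) (β₀ β₁ γ₁ γ₂ α : ℕ) :
    0 < t 0 ^ β₀ * t 1 ^ β₁ * (1 - t 1) ^ γ₁ * (1 - t 2) ^ γ₂ * (t 0 - t 2) ^ α := by
  obtain ⟨h2, h21, h10, h0'⟩ := (mem_simplex_three_iff t).1 ht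
  have ht1 : 0 < t 1 := h2.trans h21
  have ht0 : 0 < t 0 := ht1.trans h10
  have hu1 : 0 < 1 - t 1 := by linarith
  have hu2 : 0 < 1 - t 2 := by linarith
  have hd : 0 < t 0 - t 2 := by linarith
  positivity

/-- **the layer bound** `|P/den| ≤ ‖P‖₁·(M + M_d)` on `Δ₃` -/
theorem abs_layerF_le (P : MvPolynomial (Fin 3) ℚ) {β₀ β₁ γ₁ γ₂ α : ℕ} (hα : α ≤ 1) (hβ : β₁ ≤ 1) (hγ : γ₁ ≤ 1)
    (h0 : β₀ + β₁ + α ≤ 2) (h1 : γ₂ + γ₁ + α ≤ 2) {t : Fin 3 → ℝ} (ht : t ∈ KZ.openOrderedSimplex 3) :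
    |layerF P β₀ β₁ γ₁ γ₂ α t| ≤ coeffAbsSum P * (layM t + layMd t) := by
  have hden := layerDen_pos ht β₀ β₁ γ₁ γ₂ α
  rw [layerF, abs_div, abs_of_pos hden, div_eq_mul_one_div]
  exact mul_le_mul (abs_aeval_le P ht) (inv_layerDen_le ht hα hβ hγ h0 h1) (by positivity) (coeffAbsSum_nonneg P)

/-- Auxiliary step `continuousOn_layerF`. [bookkeeping] -/
theorem continuousOn_layerF (P : MvPolynomial (Fin 3) ℚ) (β₀ β₁ γ₁ γ₂ α : ℕ) :
    ContinuousOn (layerF P β₀ β₁ γ₁ γ₂ α) (KZ.openOrderedSimplex 3) :=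
  (continuous_aeval_fin P).continuousOn.div (Continuous.continuousOn (by fun_prop))
    fun _ ht => (layerDen_pos ht β₀ β₁ γ₁ γ₂ α).ne'

/-- **domination by `C·(M + M_d)`** gives integrability on `Δ₃` -/
theorem integrableOn_of_le_layM {f : (Fin 3 → ℝ) → ℝ} (hf : ContinuousOn f (KZ.openOrderedSimplex 3)) (C : ℝ)
    (h : ∀ t ∈ KZ.openOrderedSimplex 3, |f t| ≤ C * (layM t + layMd t)) : IntegrableOn f (KZ.openOrderedSimplex 3) := by
  refine Integrable.mono' ((layM_integrableOn.add layMd_integrableOn).const_mul C)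
    (hf.aestronglyMeasurable (measurableSet_simplex 3)) ?_
  rw [ae_restrict_iff' (measurableSet_simplex 3)]
  exact Filter.Eventually.of_forall fun t ht => by rw [Real.norm_eq_abs]; exact h t ht

/-- **every LAYER class is absolutely integrable on `Δ₃`** -/
theorem layer_integrableOn (P : MvPolynomial (Fin 3) ℚ) {β₀ β₁ γ₁ γ₂ α : ℕ} (hα : α ≤ 1) (hβ : β₁ ≤ 1) (hγ : γ₁ ≤ 1)
    (h0 : β₀ + β₁ + α ≤ 2) (h1 : γ₂ + γ₁ + α ≤ 2) :
    IntegrableOn (layerF P β₀ β₁ γ₁ γ₂ α) (KZ.openOrderedSimplex 3) :=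
  integrableOn_of_le_layM (continuousOn_layerF P β₀ β₁ γ₁ γ₂ α) (coeffAbsSum P)
    fun _ ht => abs_layerF_le P hα hβ hγ h0 h1 ht

/-- the layer integrand is `ℚ`-semialgebraic on `Δ₃` (a quotient of polynomials with non-vanishing denominator) -/
theorem layerF_sa (P : MvPolynomial (Fin 3) ℚ) (β₀ β₁ γ₁ γ₂ α : ℕ) :
    IsSemialgebraicFunOn ℚ (KZ.openOrderedSimplex 3) (layerF P β₀ β₁ γ₁ γ₂ α) := by
  refine (isSemialgebraicFunOn_aeval_div_aeval (KZ.isSemialgebraic_openOrderedSimplex 3) P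
    (MvPolynomial.X 0 ^ β₀ * MvPolynomial.X 1 ^ β₁ * (MvPolynomial.C 1 - MvPolynomial.X 1) ^ γ₁ *
      (MvPolynomial.C 1 - MvPolynomial.X 2) ^ γ₂ * (MvPolynomial.X 0 - MvPolynomial.X 2) ^ α) fun t ht => ?_).congr
    fun t ht => ?_
  · simp only [map_mul, map_pow, map_sub, MvPolynomial.aeval_X, map_one]
    exact (layerDen_pos ht β₀ β₁ γ₁ γ₂ α).ne'
  · simp only [map_mul, map_pow, map_sub, MvPolynomial.aeval_X, map_one, layerF]

end LayerConv
end Summit.KontsevichZagierPeriods.RootDecompZetaThreeFrontier.WordLayer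
end
end
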